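import Summits.Ventures.CertifiedManyBodySolver.Upper.SourcedBoxNodeOfTransformedWitness
import Literature.MathematicalPhysics.QuantumLattice.LiebFluxPhaseGauge
import HarnessLib

/-!
# The sourced-box CLAIM NODE from a witness in an arbitrary unitary frame (the producers' gauged frame)

HONEST FRAMING: first certified bounds; not a superconductivity verdict. Nothing here is a number or a row. This file
closes the one gap named in the docstring of `SourcedBoxNodeOfTransformedWitness.lean` (IRD desk digest
IRD5-NIGHT-0827 §A): the FORMAT-mpsgf1 producers (sr-mbsolver-var-10) and exact readers work in the frame
`a_r = c_{r↑}`, `b_r = s_r c†_{r↓}` with the STAGGERED SIGN `s_r = (-1)^{x+y}` — i.e. not in Lieb's bare partial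
particle–hole frame `W = partialParticleHole D↓` but in the tree's *gauged* Shiba frame
`S = orbitalPhase g · W` (`HubbardKuboKishiGaussianDomination`, `HubbardCanonicalSusceptibilityBounds`), `g(r↓) = s_r`,
`g(r↑) = 1`, or equivalently `W · orbitalPhase g` (the two differ by the global phase `∏_{i ∈ D↓} g i`). We prove the
claim node for a witness `ψ̃` in ANY unitary frame `S` (`Sᴴ S = 1`) under the single structural hypothesis that
`S ψ̃` has fermion parity `p` — the certified rows being the cleared Rayleigh quotients of `Sᴴ A_C S` and `Sᴴ N S`,
which is literally what a reader evaluates — and discharge the parity hypothesis for both gauged orders and every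
phase function `g` with `|g i| = 1` (a diagonal gauge moves neither supports nor particle numbers). The bare-`W`
theorems of the previous file are the case `g = 1`.

* `hasParity_orbitalPhase_mulVec`, `isNParticle_orbitalPhase_mulVec`, `star_mulVec_dotProduct_mulVec_self_of_unitary`;
* `sourcedBoxNode_of_unitaryFrameWitness` (five conjuncts), `sourcedBoxTwoFieldNode_of_unitaryFrameWitness` (seven);
* `sourcedBoxNode_of_gaugedShibaWitness` / `sourcedBoxTwoFieldNode_of_gaugedShibaWitness` (`S = orbitalPhase g · W`,
  parity `Ñ + ab`), `sourcedBoxNode_of_gaugedShibaWitness'` (`S = W · orbitalPhase g`).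
Written by the IRD desk (sr-mbsolver-ird-5); nothing of pin-1's / var-10's / obsth-2's files is touched.
-/

noncomputable section
namespace Summit.Ventures.CertifiedManyBodySolver
open Matrix Finset Literature.Probability.LatticeModels
open Literature.MathematicalPhysics.QuantumLattice Literature.MathematicalPhysics.QuantumLattice.TwoCluster
open Literature.Barriers.HubbardSuperconductivity HubbardWave0
open scoped ComplexOrder ComplexConjugate

section GaugedFrame

variable {ι : Type*} [LinearOrder ι] [Fintype ι]

/-- A diagonal gauge keeps the parity support: `HasParity p x → HasParity p (orbitalPhase g · x)`. [folklore] -/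
theorem hasParity_orbitalPhase_mulVec {p : ℕ} (g : ι → ℂ) {x : Fock ι} (hx : HasParity p x) :
    HasParity p (orbitalPhase g *ᵥ x) := by
  intro s hs
  rw [orbitalPhase, mulVec_diagonal] at hs
  exact hx s (fun h => hs (by rw [h, mul_zero]))

/-- A diagonal gauge keeps the particle number: `IsNParticle N x → IsNParticle N (orbitalPhase g · x)`. [folklore] -/
theorem isNParticle_orbitalPhase_mulVec {N : ℕ} (g : ι → ℂ) {x : Fock ι} (hx : IsNParticle N x) :
    IsNParticle N (orbitalPhase g *ᵥ x) := by
  intro s hs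
  rw [orbitalPhase, mulVec_diagonal, hx s hs, mul_zero]

/-- A unitary frame keeps the norm: `⟨Sx, Sx⟩ = ⟨x, x⟩` whenever `Sᴴ S = 1`. [folklore] -/
theorem star_mulVec_dotProduct_mulVec_self_of_unitary {S : Matrix (Finset ι) (Finset ι) ℂ} (hS : Sᴴ * S = 1)
    (x : Fock ι) : star (S *ᵥ x) ⬝ᵥ (S *ᵥ x) = star x ⬝ᵥ x := by
  rw [star_mulVec, ← dotProduct_mulVec, mulVec_mulVec, hS, one_mulVec]

/-- Products of frames with `Sᴴ S = 1` again satisfy it: `(S T)ᴴ (S T) = 1`. [folklore] -/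
theorem conjTranspose_mul_self_of_mul {S T : Matrix (Finset ι) (Finset ι) ℂ} (hS : Sᴴ * S = 1) (hT : Tᴴ * T = 1) :
    (S * T)ᴴ * (S * T) = 1 := by
  rw [conjTranspose_mul, Matrix.mul_assoc, ← Matrix.mul_assoc Sᴴ, hS, Matrix.one_mul, hT]

variable (a b : ℕ)

/-- **The claim node from a witness in any unitary frame.** Let `S` be a unitary of the box Fock space (`Sᴴ S = 1`),
`A = dWaveSourceOpenBox a b U μ h`, `N = totalNumber`, and `ψ̃` a vector with `⟨ψ̃,ψ̃⟩ > 0` whose image `S ψ̃` has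
fermion parity `p`, such that `Re⟨ψ̃, (SᴴAS)ψ̃⟩ ≤ e·ab·⟨ψ̃,ψ̃⟩` and `n_lo·ab·⟨ψ̃,ψ̃⟩ ≤ Re⟨ψ̃, (SᴴNS)ψ̃⟩ ≤ n_hi·ab·⟨ψ̃,ψ̃⟩`
(the certified Rayleigh rows of the transformed operators, cleared of denominators). Then `ψ := S ψ̃/‖ψ̃‖` witnesses
the five-conjunct sourced-box claim node with parity `p`. [cite: Lieb1989, proof of Theorem 2] -/
theorem sourcedBoxNode_of_unitaryFrameWitness (U μ h : ℝ) (e nlo nhi : ℚ) {p : ℕ}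
    (S : Matrix (Finset (Orb (Fin a ×ₗ Fin b))) (Finset (Orb (Fin a ×ₗ Fin b))) ℂ) (hS : Sᴴ * S = 1)
    (ψt : Fock (Orb (Fin a ×ₗ Fin b))) (hpar : HasParity p (S *ᵥ ψt)) (hpos : 0 < (star ψt ⬝ᵥ ψt).re)
    (hE : (star ψt ⬝ᵥ ((Sᴴ * dWaveSourceOpenBox a b U μ h * S) *ᵥ ψt)).re
          ≤ (e : ℝ) * ((a : ℝ) * b) * (star ψt ⬝ᵥ ψt).re)
    (hlo : (nlo : ℝ) * ((a : ℝ) * b) * (star ψt ⬝ᵥ ψt).re ≤ (star ψt ⬝ᵥ ((Sᴴ * totalNumber * S) *ᵥ ψt)).re)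
    (hhi : (star ψt ⬝ᵥ ((Sᴴ * totalNumber * S) *ᵥ ψt)).re ≤ (nhi : ℝ) * ((a : ℝ) * b) * (star ψt ⬝ᵥ ψt).re) :
    ∃ ψ : Fock (Orb (Fin a ×ₗ Fin b)), HasParity p ψ ∧ star ψ ⬝ᵥ ψ = 1 ∧
      (star ψ ⬝ᵥ (dWaveSourceOpenBox a b U μ h *ᵥ ψ)).re ≤ ((e : ℚ) : ℝ) * ((a : ℝ) * b) ∧
      ((nlo : ℚ) : ℝ) * ((a : ℝ) * b) ≤ (star ψ ⬝ᵥ (totalNumber *ᵥ ψ)).re ∧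
      (star ψ ⬝ᵥ (totalNumber *ᵥ ψ)).re ≤ ((nhi : ℚ) : ℝ) * ((a : ℝ) * b) := by
  set R : ℝ := (star ψt ⬝ᵥ ψt).re with hR
  have hRne : R ≠ 0 := ne_of_gt hpos
  have hself : star ψt ⬝ᵥ ψt = (R : ℂ) := by
    rw [star_dotProduct_self_eq_eucNorm_sq, hR, ← eucNorm_sq]
  have hunit : star (S *ᵥ ψt) ⬝ᵥ (S *ᵥ ψt) = (R : ℂ) := by
    rw [star_mulVec_dotProduct_mulVec_self_of_unitary hS, hself]
  set c : ℝ := 1 / Real.sqrt R with hc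
  have hcc : c * c = 1 / R := by
    rw [hc, div_mul_div_comm, one_mul, Real.mul_self_sqrt hpos.le]
  have up : ∀ (M : Matrix _ _ ℂ) (q : ℚ), (star ψt ⬝ᵥ ((Sᴴ * M * S) *ᵥ ψt)).re ≤ (q : ℝ) * ((a : ℝ) * b) * R →
      (star (((c : ℝ) : ℂ) • (S *ᵥ ψt)) ⬝ᵥ (M *ᵥ (((c : ℝ) : ℂ) • (S *ᵥ ψt)))).re ≤ ((q : ℚ) : ℝ) * ((a : ℝ) * b) := by
    intro M q hM
    rw [star_smul_dotProduct_mulVec_smul, star_mulVec_dotProduct_mulVec, Complex.re_ofReal_mul, hcc]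
    calc 1 / R * (star ψt ⬝ᵥ ((Sᴴ * M * S) *ᵥ ψt)).re ≤ 1 / R * ((q : ℝ) * ((a : ℝ) * b) * R) :=
          mul_le_mul_of_nonneg_left hM (by positivity)
      _ = ((q : ℚ) : ℝ) * ((a : ℝ) * b) := by field_simp
  have dn : ∀ (M : Matrix _ _ ℂ) (q : ℚ), (q : ℝ) * ((a : ℝ) * b) * R ≤ (star ψt ⬝ᵥ ((Sᴴ * M * S) *ᵥ ψt)).re →
      ((q : ℚ) : ℝ) * ((a : ℝ) * b) ≤ (star (((c : ℝ) : ℂ) • (S *ᵥ ψt)) ⬝ᵥ (M *ᵥ (((c : ℝ) : ℂ) • (S *ᵥ ψt)))).re := by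
    intro M q hM
    rw [star_smul_dotProduct_mulVec_smul, star_mulVec_dotProduct_mulVec, Complex.re_ofReal_mul, hcc]
    calc ((q : ℚ) : ℝ) * ((a : ℝ) * b) = 1 / R * ((q : ℝ) * ((a : ℝ) * b) * R) := by field_simp
      _ ≤ 1 / R * (star ψt ⬝ᵥ ((Sᴴ * M * S) *ᵥ ψt)).re := mul_le_mul_of_nonneg_left hM (by positivity)
  refine ⟨((c : ℝ) : ℂ) • (S *ᵥ ψt), hasParity_smul _ hpar, ?_, up _ _ hE, dn _ _ hlo, up _ _ hhi⟩
  have := star_smul_dotProduct_mulVec_smul c (1 : Matrix _ _ ℂ) (S *ᵥ ψt)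
  rw [one_mulVec, one_mulVec] at this
  rw [this, hcc, hunit, ← Complex.ofReal_mul, div_mul_cancel₀ _ hRne, Complex.ofReal_one]

/-- **The TWO-FIELD claim node from a witness in any unitary frame** (hubbard-cq-obsth-2's seven-conjunct shape): as
`sourcedBoxNode_of_unitaryFrameWitness`, plus the cleared rows `e0lo·ab·⟨ψ̃,ψ̃⟩ ≤ Re⟨ψ̃, (Sᴴ A_C(μ,0) S)ψ̃⟩ ≤ e0hi·ab·⟨ψ̃,ψ̃⟩`
for the zero-field operator of the SAME vector. [cite: Lieb1989, proof of Theorem 2] -/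
theorem sourcedBoxTwoFieldNode_of_unitaryFrameWitness (U μ h : ℝ) (e nlo nhi e0lo e0hi : ℚ) {p : ℕ}
    (S : Matrix (Finset (Orb (Fin a ×ₗ Fin b))) (Finset (Orb (Fin a ×ₗ Fin b))) ℂ) (hS : Sᴴ * S = 1)
    (ψt : Fock (Orb (Fin a ×ₗ Fin b))) (hpar : HasParity p (S *ᵥ ψt)) (hpos : 0 < (star ψt ⬝ᵥ ψt).re)
    (hE : (star ψt ⬝ᵥ ((Sᴴ * dWaveSourceOpenBox a b U μ h * S) *ᵥ ψt)).re
          ≤ (e : ℝ) * ((a : ℝ) * b) * (star ψt ⬝ᵥ ψt).re)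
    (hlo : (nlo : ℝ) * ((a : ℝ) * b) * (star ψt ⬝ᵥ ψt).re ≤ (star ψt ⬝ᵥ ((Sᴴ * totalNumber * S) *ᵥ ψt)).re)
    (hhi : (star ψt ⬝ᵥ ((Sᴴ * totalNumber * S) *ᵥ ψt)).re ≤ (nhi : ℝ) * ((a : ℝ) * b) * (star ψt ⬝ᵥ ψt).re)
    (h0lo : (e0lo : ℝ) * ((a : ℝ) * b) * (star ψt ⬝ᵥ ψt).re
          ≤ (star ψt ⬝ᵥ ((Sᴴ * dWaveSourceOpenBox a b U μ 0 * S) *ᵥ ψt)).re)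
    (h0hi : (star ψt ⬝ᵥ ((Sᴴ * dWaveSourceOpenBox a b U μ 0 * S) *ᵥ ψt)).re
          ≤ (e0hi : ℝ) * ((a : ℝ) * b) * (star ψt ⬝ᵥ ψt).re) :
    ∃ ψ : Fock (Orb (Fin a ×ₗ Fin b)), HasParity p ψ ∧ star ψ ⬝ᵥ ψ = 1 ∧
      (star ψ ⬝ᵥ (dWaveSourceOpenBox a b U μ h *ᵥ ψ)).re ≤ ((e : ℚ) : ℝ) * ((a : ℝ) * b) ∧
      ((nlo : ℚ) : ℝ) * ((a : ℝ) * b) ≤ (star ψ ⬝ᵥ (totalNumber *ᵥ ψ)).re ∧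
      (star ψ ⬝ᵥ (totalNumber *ᵥ ψ)).re ≤ ((nhi : ℚ) : ℝ) * ((a : ℝ) * b) ∧
      ((e0lo : ℚ) : ℝ) * ((a : ℝ) * b) ≤ (star ψ ⬝ᵥ (dWaveSourceOpenBox a b U μ 0 *ᵥ ψ)).re ∧
      (star ψ ⬝ᵥ (dWaveSourceOpenBox a b U μ 0 *ᵥ ψ)).re ≤ ((e0hi : ℚ) : ℝ) * ((a : ℝ) * b) := by
  set R : ℝ := (star ψt ⬝ᵥ ψt).re with hR
  have hRne : R ≠ 0 := ne_of_gt hpos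
  have hself : star ψt ⬝ᵥ ψt = (R : ℂ) := by
    rw [star_dotProduct_self_eq_eucNorm_sq, hR, ← eucNorm_sq]
  have hunit : star (S *ᵥ ψt) ⬝ᵥ (S *ᵥ ψt) = (R : ℂ) := by
    rw [star_mulVec_dotProduct_mulVec_self_of_unitary hS, hself]
  set c : ℝ := 1 / Real.sqrt R with hc
  have hcc : c * c = 1 / R := by
    rw [hc, div_mul_div_comm, one_mul, Real.mul_self_sqrt hpos.le]
  have up : ∀ (M : Matrix _ _ ℂ) (q : ℚ), (star ψt ⬝ᵥ ((Sᴴ * M * S) *ᵥ ψt)).re ≤ (q : ℝ) * ((a : ℝ) * b) * R →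
      (star (((c : ℝ) : ℂ) • (S *ᵥ ψt)) ⬝ᵥ (M *ᵥ (((c : ℝ) : ℂ) • (S *ᵥ ψt)))).re ≤ ((q : ℚ) : ℝ) * ((a : ℝ) * b) := by
    intro M q hM
    rw [star_smul_dotProduct_mulVec_smul, star_mulVec_dotProduct_mulVec, Complex.re_ofReal_mul, hcc]
    calc 1 / R * (star ψt ⬝ᵥ ((Sᴴ * M * S) *ᵥ ψt)).re ≤ 1 / R * ((q : ℝ) * ((a : ℝ) * b) * R) :=
          mul_le_mul_of_nonneg_left hM (by positivity)
      _ = ((q : ℚ) : ℝ) * ((a : ℝ) * b) := by field_simp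
  have dn : ∀ (M : Matrix _ _ ℂ) (q : ℚ), (q : ℝ) * ((a : ℝ) * b) * R ≤ (star ψt ⬝ᵥ ((Sᴴ * M * S) *ᵥ ψt)).re →
      ((q : ℚ) : ℝ) * ((a : ℝ) * b) ≤ (star (((c : ℝ) : ℂ) • (S *ᵥ ψt)) ⬝ᵥ (M *ᵥ (((c : ℝ) : ℂ) • (S *ᵥ ψt)))).re := by
    intro M q hM
    rw [star_smul_dotProduct_mulVec_smul, star_mulVec_dotProduct_mulVec, Complex.re_ofReal_mul, hcc]
    calc ((q : ℚ) : ℝ) * ((a : ℝ) * b) = 1 / R * ((q : ℝ) * ((a : ℝ) * b) * R) := by field_simp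
      _ ≤ 1 / R * (star ψt ⬝ᵥ ((Sᴴ * M * S) *ᵥ ψt)).re := mul_le_mul_of_nonneg_left hM (by positivity)
  refine ⟨((c : ℝ) : ℂ) • (S *ᵥ ψt), hasParity_smul _ hpar, ?_, up _ _ hE, dn _ _ hlo, up _ _ hhi,
    dn _ _ h0lo, up _ _ h0hi⟩
  have := star_smul_dotProduct_mulVec_smul c (1 : Matrix _ _ ℂ) (S *ᵥ ψt)
  rw [one_mulVec, one_mulVec] at this
  rw [this, hcc, hunit, ← Complex.ofReal_mul, div_mul_cancel₀ _ hRne, Complex.ofReal_one]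

/-- The gauged Shiba frame `S = orbitalPhase g · partialParticleHole D↓` is a unitary: `Sᴴ S = 1` (`|g i| = 1`).
[cite: Lieb1989, proof of Theorem 2] -/
theorem conjTranspose_gaugedShiba_mul_self {g : Orb (Fin a ×ₗ Fin b) → ℂ} (hg : ∀ i, ‖g i‖ = 1) :
    (orbitalPhase g * partialParticleHole (spinDownOrbitals : Finset (Orb (Fin a ×ₗ Fin b))))ᴴ *
      (orbitalPhase g * partialParticleHole (spinDownOrbitals : Finset (Orb (Fin a ×ₗ Fin b)))) = 1 :=
  conjTranspose_mul_self_of_mul (conjTranspose_orbitalPhase_mul hg) (partialParticleHole_conjTranspose_mul _)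

/-- In the gauged Shiba frame an `Ñ`-particle vector is carried to a vector of fermion parity `Ñ + ab`:
`HasParity (Ñ + ab) ((orbitalPhase g · W) ψ̃)`. [cite: Lieb1989, proof of Theorem 2] -/
theorem hasParity_gaugedShiba_mulVec (g : Orb (Fin a ×ₗ Fin b) → ℂ) {Nt : ℕ} {ψt : Fock (Orb (Fin a ×ₗ Fin b))}
    (hN : IsNParticle Nt ψt) :
    HasParity (Nt + a * b)
      ((orbitalPhase g * partialParticleHole (spinDownOrbitals : Finset (Orb (Fin a ×ₗ Fin b)))) *ᵥ ψt) := by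
  rw [← mulVec_mulVec]
  have hp := hasParity_partialParticleHole_mulVec_of_isNParticle
    (spinDownOrbitals : Finset (Orb (Fin a ×ₗ Fin b))) hN
  rw [card_spinDownOrbitals_box] at hp
  exact hasParity_orbitalPhase_mulVec g hp

/-- Same for the other order `S = W · orbitalPhase g`: `HasParity (Ñ + ab) ((W · orbitalPhase g) ψ̃)`.
[cite: Lieb1989, proof of Theorem 2] -/
theorem hasParity_gaugedShiba'_mulVec (g : Orb (Fin a ×ₗ Fin b) → ℂ) {Nt : ℕ} {ψt : Fock (Orb (Fin a ×ₗ Fin b))}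
    (hN : IsNParticle Nt ψt) :
    HasParity (Nt + a * b)
      ((partialParticleHole (spinDownOrbitals : Finset (Orb (Fin a ×ₗ Fin b))) * orbitalPhase g) *ᵥ ψt) := by
  rw [← mulVec_mulVec]
  have hp := hasParity_partialParticleHole_mulVec_of_isNParticle
    (spinDownOrbitals : Finset (Orb (Fin a ×ₗ Fin b))) (isNParticle_orbitalPhase_mulVec g hN)
  rwa [card_spinDownOrbitals_box] at hp

/-- **The claim node from a witness in the producers' gauged Shiba frame** `S = orbitalPhase g · partialParticleHole D↓`
(any phases `|g i| = 1`; the FORMAT-mpsgf1 frame is `g(r↓) = (-1)^{x+y}`, `g(r↑) = 1`): an `Ñ`-particle `ψ̃` with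
`⟨ψ̃,ψ̃⟩ > 0` and the cleared Rayleigh rows of `Sᴴ A_C S`, `Sᴴ N S` gives the five-conjunct node with parity `Ñ + ab`.
[cite: Lieb1989, proof of Theorem 2] -/
theorem sourcedBoxNode_of_gaugedShibaWitness (U μ h : ℝ) (e nlo nhi : ℚ) {g : Orb (Fin a ×ₗ Fin b) → ℂ}
    (hg : ∀ i, ‖g i‖ = 1) {Nt : ℕ} (ψt : Fock (Orb (Fin a ×ₗ Fin b))) (hN : IsNParticle Nt ψt)
    (hpos : 0 < (star ψt ⬝ᵥ ψt).re)
    (hE : (star ψt ⬝ᵥ (((orbitalPhase g * partialParticleHole (spinDownOrbitals : Finset (Orb (Fin a ×ₗ Fin b))))ᴴ *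
            dWaveSourceOpenBox a b U μ h *
            (orbitalPhase g * partialParticleHole (spinDownOrbitals : Finset (Orb (Fin a ×ₗ Fin b))))) *ᵥ ψt)).re
          ≤ (e : ℝ) * ((a : ℝ) * b) * (star ψt ⬝ᵥ ψt).re)
    (hlo : (nlo : ℝ) * ((a : ℝ) * b) * (star ψt ⬝ᵥ ψt).re ≤
          (star ψt ⬝ᵥ (((orbitalPhase g * partialParticleHole (spinDownOrbitals : Finset (Orb (Fin a ×ₗ Fin b))))ᴴ *
            totalNumber *
            (orbitalPhase g * partialParticleHole (spinDownOrbitals : Finset (Orb (Fin a ×ₗ Fin b))))) *ᵥ ψt)).re)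
    (hhi : (star ψt ⬝ᵥ (((orbitalPhase g * partialParticleHole (spinDownOrbitals : Finset (Orb (Fin a ×ₗ Fin b))))ᴴ *
            totalNumber *
            (orbitalPhase g * partialParticleHole (spinDownOrbitals : Finset (Orb (Fin a ×ₗ Fin b))))) *ᵥ ψt)).re
          ≤ (nhi : ℝ) * ((a : ℝ) * b) * (star ψt ⬝ᵥ ψt).re) :
    ∃ ψ : Fock (Orb (Fin a ×ₗ Fin b)), HasParity (Nt + a * b) ψ ∧ star ψ ⬝ᵥ ψ = 1 ∧
      (star ψ ⬝ᵥ (dWaveSourceOpenBox a b U μ h *ᵥ ψ)).re ≤ ((e : ℚ) : ℝ) * ((a : ℝ) * b) ∧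
      ((nlo : ℚ) : ℝ) * ((a : ℝ) * b) ≤ (star ψ ⬝ᵥ (totalNumber *ᵥ ψ)).re ∧
      (star ψ ⬝ᵥ (totalNumber *ᵥ ψ)).re ≤ ((nhi : ℚ) : ℝ) * ((a : ℝ) * b) :=
  sourcedBoxNode_of_unitaryFrameWitness a b U μ h e nlo nhi _ (conjTranspose_gaugedShiba_mul_self a b hg) ψt
    (hasParity_gaugedShiba_mulVec a b g hN) hpos hE hlo hhi

/-- **The TWO-FIELD claim node from a witness in the producers' gauged Shiba frame** (seven conjuncts; the two
extra rows are the cleared Rayleigh quotients of `Sᴴ A_C(μ,0) S`, for an exact reader `E_mu0 + κ·X`).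
[cite: Lieb1989, proof of Theorem 2] -/
theorem sourcedBoxTwoFieldNode_of_gaugedShibaWitness (U μ h : ℝ) (e nlo nhi e0lo e0hi : ℚ)
    {g : Orb (Fin a ×ₗ Fin b) → ℂ} (hg : ∀ i, ‖g i‖ = 1) {Nt : ℕ} (ψt : Fock (Orb (Fin a ×ₗ Fin b)))
    (hN : IsNParticle Nt ψt) (hpos : 0 < (star ψt ⬝ᵥ ψt).re)
    (hE : (star ψt ⬝ᵥ (((orbitalPhase g * partialParticleHole (spinDownOrbitals : Finset (Orb (Fin a ×ₗ Fin b))))ᴴ *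
            dWaveSourceOpenBox a b U μ h *
            (orbitalPhase g * partialParticleHole (spinDownOrbitals : Finset (Orb (Fin a ×ₗ Fin b))))) *ᵥ ψt)).re
          ≤ (e : ℝ) * ((a : ℝ) * b) * (star ψt ⬝ᵥ ψt).re)
    (hlo : (nlo : ℝ) * ((a : ℝ) * b) * (star ψt ⬝ᵥ ψt).re ≤
          (star ψt ⬝ᵥ (((orbitalPhase g * partialParticleHole (spinDownOrbitals : Finset (Orb (Fin a ×ₗ Fin b))))ᴴ *
            totalNumber *
            (orbitalPhase g * partialParticleHole (spinDownOrbitals : Finset (Orb (Fin a ×ₗ Fin b))))) *ᵥ ψt)).re)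
    (hhi : (star ψt ⬝ᵥ (((orbitalPhase g * partialParticleHole (spinDownOrbitals : Finset (Orb (Fin a ×ₗ Fin b))))ᴴ *
            totalNumber *
            (orbitalPhase g * partialParticleHole (spinDownOrbitals : Finset (Orb (Fin a ×ₗ Fin b))))) *ᵥ ψt)).re
          ≤ (nhi : ℝ) * ((a : ℝ) * b) * (star ψt ⬝ᵥ ψt).re)
    (h0lo : (e0lo : ℝ) * ((a : ℝ) * b) * (star ψt ⬝ᵥ ψt).re ≤
          (star ψt ⬝ᵥ (((orbitalPhase g * partialParticleHole (spinDownOrbitals : Finset (Orb (Fin a ×ₗ Fin b))))ᴴ *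
            dWaveSourceOpenBox a b U μ 0 *
            (orbitalPhase g * partialParticleHole (spinDownOrbitals : Finset (Orb (Fin a ×ₗ Fin b))))) *ᵥ ψt)).re)
    (h0hi : (star ψt ⬝ᵥ (((orbitalPhase g * partialParticleHole (spinDownOrbitals : Finset (Orb (Fin a ×ₗ Fin b))))ᴴ *
            dWaveSourceOpenBox a b U μ 0 *
            (orbitalPhase g * partialParticleHole (spinDownOrbitals : Finset (Orb (Fin a ×ₗ Fin b))))) *ᵥ ψt)).re
          ≤ (e0hi : ℝ) * ((a : ℝ) * b) * (star ψt ⬝ᵥ ψt).re) :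
    ∃ ψ : Fock (Orb (Fin a ×ₗ Fin b)), HasParity (Nt + a * b) ψ ∧ star ψ ⬝ᵥ ψ = 1 ∧
      (star ψ ⬝ᵥ (dWaveSourceOpenBox a b U μ h *ᵥ ψ)).re ≤ ((e : ℚ) : ℝ) * ((a : ℝ) * b) ∧
      ((nlo : ℚ) : ℝ) * ((a : ℝ) * b) ≤ (star ψ ⬝ᵥ (totalNumber *ᵥ ψ)).re ∧
      (star ψ ⬝ᵥ (totalNumber *ᵥ ψ)).re ≤ ((nhi : ℚ) : ℝ) * ((a : ℝ) * b) ∧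
      ((e0lo : ℚ) : ℝ) * ((a : ℝ) * b) ≤ (star ψ ⬝ᵥ (dWaveSourceOpenBox a b U μ 0 *ᵥ ψ)).re ∧
      (star ψ ⬝ᵥ (dWaveSourceOpenBox a b U μ 0 *ᵥ ψ)).re ≤ ((e0hi : ℚ) : ℝ) * ((a : ℝ) * b) :=
  sourcedBoxTwoFieldNode_of_unitaryFrameWitness a b U μ h e nlo nhi e0lo e0hi _
    (conjTranspose_gaugedShiba_mul_self a b hg) ψt (hasParity_gaugedShiba_mulVec a b g hN) hpos hE hlo hhi h0lo h0hi

/-- **The claim node in the other gauged order** `S = partialParticleHole D↓ · orbitalPhase g` (equal to the Shiba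
order up to the global phase `∏_{i ∈ D↓} g i`, hence with the same Rayleigh rows). [cite: Lieb1989, proof of Theorem 2] -/
theorem sourcedBoxNode_of_gaugedShibaWitness' (U μ h : ℝ) (e nlo nhi : ℚ) {g : Orb (Fin a ×ₗ Fin b) → ℂ}
    (hg : ∀ i, ‖g i‖ = 1) {Nt : ℕ} (ψt : Fock (Orb (Fin a ×ₗ Fin b))) (hN : IsNParticle Nt ψt)
    (hpos : 0 < (star ψt ⬝ᵥ ψt).re)
    (hE : (star ψt ⬝ᵥ (((partialParticleHole (spinDownOrbitals : Finset (Orb (Fin a ×ₗ Fin b))) * orbitalPhase g)ᴴ *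
            dWaveSourceOpenBox a b U μ h *
            (partialParticleHole (spinDownOrbitals : Finset (Orb (Fin a ×ₗ Fin b))) * orbitalPhase g)) *ᵥ ψt)).re
          ≤ (e : ℝ) * ((a : ℝ) * b) * (star ψt ⬝ᵥ ψt).re)
    (hlo : (nlo : ℝ) * ((a : ℝ) * b) * (star ψt ⬝ᵥ ψt).re ≤
          (star ψt ⬝ᵥ (((partialParticleHole (spinDownOrbitals : Finset (Orb (Fin a ×ₗ Fin b))) * orbitalPhase g)ᴴ *
            totalNumber *
            (partialParticleHole (spinDownOrbitals : Finset (Orb (Fin a ×ₗ Fin b))) * orbitalPhase g)) *ᵥ ψt)).re)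
    (hhi : (star ψt ⬝ᵥ (((partialParticleHole (spinDownOrbitals : Finset (Orb (Fin a ×ₗ Fin b))) * orbitalPhase g)ᴴ *
            totalNumber *
            (partialParticleHole (spinDownOrbitals : Finset (Orb (Fin a ×ₗ Fin b))) * orbitalPhase g)) *ᵥ ψt)).re
          ≤ (nhi : ℝ) * ((a : ℝ) * b) * (star ψt ⬝ᵥ ψt).re) :
    ∃ ψ : Fock (Orb (Fin a ×ₗ Fin b)), HasParity (Nt + a * b) ψ ∧ star ψ ⬝ᵥ ψ = 1 ∧
      (star ψ ⬝ᵥ (dWaveSourceOpenBox a b U μ h *ᵥ ψ)).re ≤ ((e : ℚ) : ℝ) * ((a : ℝ) * b) ∧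
      ((nlo : ℚ) : ℝ) * ((a : ℝ) * b) ≤ (star ψ ⬝ᵥ (totalNumber *ᵥ ψ)).re ∧
      (star ψ ⬝ᵥ (totalNumber *ᵥ ψ)).re ≤ ((nhi : ℚ) : ℝ) * ((a : ℝ) * b) :=
  sourcedBoxNode_of_unitaryFrameWitness a b U μ h e nlo nhi _
    (conjTranspose_mul_self_of_mul (partialParticleHole_conjTranspose_mul _) (conjTranspose_orbitalPhase_mul hg)) ψt
    (hasParity_gaugedShiba'_mulVec a b g hN) hpos hE hlo hhi

end GaugedFrame

/-! ### The producers' §2 generator dictionary of the gauged Shiba frame (any finite orbital set of sites `Λ`) -/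

section Dictionary

variable {Λ : Type*} [LinearOrder Λ] [Fintype Λ]

omit [Fintype Λ] in
/-- The adjoint of a diagonal gauge is the gauge with conjugate phases: `(orbitalPhase g)ᴴ = orbitalPhase (star ∘ g)`.
[folklore] -/
theorem conjTranspose_orbitalPhase (g : Orb Λ → ℂ) : (orbitalPhase g)ᴴ = orbitalPhase (star ∘ g) := by
  rw [orbitalPhase, orbitalPhase, diagonal_conjTranspose]
  congr 1
  funext s
  rw [Pi.star_apply, star_prod]
  rfl

/-- Conjugation by the gauged Shiba frame factors through its two layers:
`(G·W) X (G·W)ᴴ = G (W X Wᴴ) Gᴴ`. [folklore] -/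
theorem gaugedShiba_conj_eq (g : Orb Λ → ℂ) (X : Matrix (Finset (Orb Λ)) (Finset (Orb Λ)) ℂ) :
    orbitalPhase g * partialParticleHole (spinDownOrbitals : Finset (Orb Λ)) * X *
        (orbitalPhase g * partialParticleHole (spinDownOrbitals : Finset (Orb Λ)))ᴴ =
      orbitalPhase g * (partialParticleHole (spinDownOrbitals : Finset (Orb Λ)) * X *
        (partialParticleHole (spinDownOrbitals : Finset (Orb Λ)))ᴴ) * (orbitalPhase g)ᴴ := by
  rw [conjTranspose_mul]
  simp only [Matrix.mul_assoc]

/-- **§2, up modes: `S c_{x↑} Sᴴ = (g(x↑))^* · c_{x↑}`** for `S = orbitalPhase g · partialParticleHole D↓`; with the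
producers' `g(x↑) = 1` this reads `a_x = c_{x↑}`. [cite: Lieb1989, proof of Theorem 2] -/
theorem gaugedShiba_conj_annihilation_up {g : Orb Λ → ℂ} (hg : ∀ i, ‖g i‖ = 1) (x : Λ) :
    orbitalPhase g * partialParticleHole (spinDownOrbitals : Finset (Orb Λ)) * annihilation (orb x 0) *
        (orbitalPhase g * partialParticleHole (spinDownOrbitals : Finset (Orb Λ)))ᴴ =
      star (g (orb x 0)) • annihilation (orb x 0) := by
  rw [gaugedShiba_conj_eq, partialParticleHole_conj_annihilation_of_not_mem
    (by rw [orb_mem_spinDownOrbitals_iff]; decide), orbitalPhase_conj_annihilation hg]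

/-- **§2, up modes, adjoint: `S c†_{x↑} Sᴴ = g(x↑) · c†_{x↑}`** (`a†_x = c†_{x↑}` for `g(x↑) = 1`).
[cite: Lieb1989, proof of Theorem 2] -/
theorem gaugedShiba_conj_creation_up {g : Orb Λ → ℂ} (hg : ∀ i, ‖g i‖ = 1) (x : Λ) :
    orbitalPhase g * partialParticleHole (spinDownOrbitals : Finset (Orb Λ)) * creation (orb x 0) *
        (orbitalPhase g * partialParticleHole (spinDownOrbitals : Finset (Orb Λ)))ᴴ =
      g (orb x 0) • creation (orb x 0) := by
  rw [gaugedShiba_conj_eq, partialParticleHole_conj_creation_of_not_mem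
    (by rw [orb_mem_spinDownOrbitals_iff]; decide), orbitalPhase_conj_creation hg]

/-- **§2, down modes: `S c_{x↓} Sᴴ = g(x↓) · c†_{x↓}`** — Lieb's particle–hole exchange on the down spins with
the gauge phase; for the producers' `g(x↓) = (-1)^{x+y}` this reads `b_r = s_r c†_{r↓}`, `s_r = (-1)^{x+y}`
(FORMAT-mpsgf1 §2). [cite: Lieb1989, proof of Theorem 2] -/
theorem gaugedShiba_conj_annihilation_down {g : Orb Λ → ℂ} (hg : ∀ i, ‖g i‖ = 1) (x : Λ) :
    orbitalPhase g * partialParticleHole (spinDownOrbitals : Finset (Orb Λ)) * annihilation (orb x 1) *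
        (orbitalPhase g * partialParticleHole (spinDownOrbitals : Finset (Orb Λ)))ᴴ =
      g (orb x 1) • creation (orb x 1) := by
  rw [gaugedShiba_conj_eq, partialParticleHole_conj_annihilation_of_mem
    (by rw [orb_mem_spinDownOrbitals_iff]), orbitalPhase_conj_creation hg]

/-- **§2, down modes, adjoint: `S c†_{x↓} Sᴴ = (g(x↓))^* · c_{x↓}`** (`b†_r = s_r c_{r↓}` for real signs `s_r`).
[cite: Lieb1989, proof of Theorem 2] -/
theorem gaugedShiba_conj_creation_down {g : Orb Λ → ℂ} (hg : ∀ i, ‖g i‖ = 1) (x : Λ) :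
    orbitalPhase g * partialParticleHole (spinDownOrbitals : Finset (Orb Λ)) * creation (orb x 1) *
        (orbitalPhase g * partialParticleHole (spinDownOrbitals : Finset (Orb Λ)))ᴴ =
      star (g (orb x 1)) • annihilation (orb x 1) := by
  rw [gaugedShiba_conj_eq, partialParticleHole_conj_creation_of_mem
    (by rw [orb_mem_spinDownOrbitals_iff]), orbitalPhase_conj_annihilation hg]

/-- The gauged Shiba frame keeps every up density and exchanges particle and hole densities on the down spins:
`S n_{x↑} Sᴴ = n_{x↑}`, `S n_{x↓} Sᴴ = 1 - n_{x↓}` (phases cancel, `|g| = 1`). [cite: Lieb1989, proof of Theorem 2] -/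
theorem gaugedShiba_conj_numberOp {g : Orb Λ → ℂ} (hg : ∀ i, ‖g i‖ = 1) (x : Λ) :
    orbitalPhase g * partialParticleHole (spinDownOrbitals : Finset (Orb Λ)) * numberOp x 0 *
        (orbitalPhase g * partialParticleHole (spinDownOrbitals : Finset (Orb Λ)))ᴴ = numberOp x 0 ∧
    orbitalPhase g * partialParticleHole (spinDownOrbitals : Finset (Orb Λ)) * numberOp x 1 *
        (orbitalPhase g * partialParticleHole (spinDownOrbitals : Finset (Orb Λ)))ᴴ = 1 - numberOp x 1 := by
  have hgg : ∀ i, g i * star (g i) = 1 := fun i => by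
    rw [Complex.star_def, Complex.mul_conj, Complex.normSq_eq_norm_sq, hg i]; norm_num
  have key : ∀ σ : Fin 2, orbitalPhase g * partialParticleHole (spinDownOrbitals : Finset (Orb Λ)) * numberOp x σ *
        (orbitalPhase g * partialParticleHole (spinDownOrbitals : Finset (Orb Λ)))ᴴ =
      (orbitalPhase g * partialParticleHole (spinDownOrbitals : Finset (Orb Λ)) * creation (orb x σ) *
        (orbitalPhase g * partialParticleHole (spinDownOrbitals : Finset (Orb Λ)))ᴴ) *
      (orbitalPhase g * partialParticleHole (spinDownOrbitals : Finset (Orb Λ)) * annihilation (orb x σ) *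
        (orbitalPhase g * partialParticleHole (spinDownOrbitals : Finset (Orb Λ)))ᴴ) := by
    intro σ
    set S := orbitalPhase g * partialParticleHole (spinDownOrbitals : Finset (Orb Λ)) with hS
    have hSS : Sᴴ * S = 1 :=
      conjTranspose_mul_self_of_mul (conjTranspose_orbitalPhase_mul hg) (partialParticleHole_conjTranspose_mul _)
    rw [numberOp]
    calc S * (creation (orb x σ) * annihilation (orb x σ)) * Sᴴ
        = S * creation (orb x σ) * (Sᴴ * S) * annihilation (orb x σ) * Sᴴ := by
          rw [hSS]; simp only [Matrix.mul_assoc, Matrix.one_mul]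
      _ = S * creation (orb x σ) * Sᴴ * (S * annihilation (orb x σ) * Sᴴ) := by simp only [Matrix.mul_assoc]
  refine ⟨?_, ?_⟩
  · rw [key, gaugedShiba_conj_creation_up hg, gaugedShiba_conj_annihilation_up hg, Matrix.smul_mul,
      Matrix.mul_smul, smul_smul, hgg, one_smul, numberOp]
  · rw [key, gaugedShiba_conj_creation_down hg, gaugedShiba_conj_annihilation_down hg, Matrix.smul_mul,
      Matrix.mul_smul, smul_smul, mul_comm, hgg, one_smul, numberOp, annihilation_mul_creation, if_pos rfl]

end Dictionary

end Summit.Ventures.CertifiedManyBodySolver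
end
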